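import Summits.BirchSwinnertonDyer.BirchSwinnertonDyer.Theses.ShadowIsolation
import Literature.NumberTheory.EllipticCurves.SerreOpenImageFinalProofs
import Literature.NumberTheory.EllipticCurves.SupersingularDensityProofs
import Literature.NumberTheory.EllipticCurves.ComplexMultiplicationRationalJIntegralProofs

/-!
# Non-vacuity of the hypothesis block of `SelmerRankUB` (stmt-BirchSwinnertonDyer-0130), in Lean

The crux quantifies over `W` elliptic and globally minimal and a prime `p ≥ 5` of good ordinary
reduction with surjective mod-`p` representation. This file inhabits that hypothesis block
kernel-checked: start from `37a1 : y² + y = x³ − x` (`Δ = 37`, `j = 110592/37 = 2¹²·3³/37`),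
pass to a global minimal model `C • W₀` (tree theorem `hasGlobalMinimalModel_rat_holds`), observe
`‖j‖₃₇ = 37 > 1` so the curve has no CM (tree theorem `not_hasCM_of_one_lt_norm_j`), and take the
big-image good ordinary prime `p ≥ 5` supplied by Serre's open image theorem
(`serre_open_image_holds`) and the infinitude of good ordinary primes
(`infinite_goodOrdinaryPrimes_holds`), both proved in tree (this is the landed
`Theorems.exists_goodOrdinary_surjective_of_not_hasCM`, re-derived here over Literature imports only
so that the file does not depend on route TangentCone's module). Finally the witness is fed to the
crux: under `SelmerRankUB` the inequality holds at an honest instance (`ub_applies_somewhere`).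
-/

set_option linter.dupNamespace false

namespace Summit.BirchSwinnertonDyer.BirchSwinnertonDyer.Cruxes.SelmerRankUB.CruxAttack

open Summit.BirchSwinnertonDyer.BirchSwinnertonDyer
open Literature.NumberTheory.EllipticCurves

/-- `37a1`: `y² + y = x³ − x`. [folklore] -/
def W37 : WeierstrassCurve ℚ := ⟨0, 0, 1, -1, 0⟩

theorem W37_Δ : W37.Δ = 37 := by
  norm_num [W37, WeierstrassCurve.Δ, WeierstrassCurve.b₂, WeierstrassCurve.b₄, WeierstrassCurve.b₆,
    WeierstrassCurve.b₈]

theorem W37_c₄ : W37.c₄ = 48 := by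
  norm_num [W37, WeierstrassCurve.c₄, WeierstrassCurve.b₂, WeierstrassCurve.b₄]

instance : W37.IsElliptic := ⟨by rw [W37_Δ]; norm_num⟩

theorem W37_j : W37.j = 110592 / 37 := by
  rw [WeierstrassCurve.j, Units.val_inv_eq_inv_val, WeierstrassCurve.coe_Δ', W37_c₄, W37_Δ]
  norm_num

instance fact_prime_37 : Fact (Nat.Prime 37) := ⟨by norm_num⟩

theorem one_lt_norm_j_37 : 1 < ‖((110592 / 37 : ℚ) : ℚ_[37])‖ := by
  rw [Padic.eq_padicNorm, padicNorm.div]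
  have h1 : padicNorm 37 (110592 : ℚ) = 1 := by
    have : ¬ 37 ∣ 110592 := by norm_num
    exact_mod_cast (padicNorm.nat_eq_one_iff 110592).2 this
  have h2 : padicNorm 37 (37 : ℚ) = (37 : ℚ)⁻¹ := by
    exact_mod_cast padicNorm.padicNorm_p_of_prime (p := 37)
  rw [h1, h2]
  norm_num

/-- **Non-vacuity, kernel-checked.** The hypothesis block of the crux `SelmerRankUB` is
inhabited: some globally minimal elliptic `W/ℚ` (a global minimal model of `37a1`) and some prime
`p ≥ 5` of good ordinary reduction with surjective mod-`p` Galois representation. [folklore] -/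
theorem hypotheses_inhabited :
    ∃ (W : WeierstrassCurve ℚ) (_ : W.IsElliptic) (_ : W.IsGloballyMinimal) (p : ℕ) (_ : Fact p.Prime),
      5 ≤ p ∧ W.HasGoodReductionAtPrime p ∧ ¬ (p : ℤ) ∣ W.frobeniusTrace p ∧
        W.HasSurjectiveModNGaloisRep p := by
  obtain ⟨C, hC⟩ := WeierstrassCurve.hasGlobalMinimalModel_rat_holds W37
  haveI := hC
  have hj : (C • W37).j = 110592 / 37 := by rw [WeierstrassCurve.variableChange_j, W37_j]
  have hnCM : ¬ (C • W37).HasCM :=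
    (C • W37).not_hasCM_of_one_lt_norm_j (ℓ := 37) (by rw [hj]; exact one_lt_norm_j_37)
  obtain ⟨p₀, hp₀⟩ := serre_open_image_holds (C • W37) hnCM
  obtain ⟨p, ⟨hp, hgood, hord⟩, hlt⟩ :=
    (WeierstrassCurve.infinite_goodOrdinaryPrimes_holds (C • W37)).exists_gt (max p₀ 4)
  have h5 : 5 ≤ p := by
    have := le_max_right p₀ 4
    omega
  have hle : p₀ ≤ p := by
    have := le_max_left p₀ 4
    omega
  exact ⟨C • W37, inferInstance, hC, p, hp, h5, hgood, hord, hp₀ p hp.out hle⟩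

/-- The crux is exercised at an honest instance: under `SelmerRankUB` there are `W`, `p` meeting
all five hypotheses, where it yields `corank_p Sel ≤ r_an` (so the universal statement is not
vacuously true). [folklore] -/
theorem ub_applies_somewhere (h : Theses.ShadowIsolation.SelmerRankUB) :
    ∃ (W : WeierstrassCurve ℚ) (_ : W.IsElliptic) (p : ℕ) (_ : Fact p.Prime),
      W.HasSurjectiveModNGaloisRep p ∧ W.selmerCorank p ≤ W.analyticRank := by
  obtain ⟨W, hE, hM, p, hp, h5, hg, ho, hs⟩ := hypotheses_inhabited
  exact ⟨W, hE, p, hp, hs, h W p h5 hg ho hs⟩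

end Summit.BirchSwinnertonDyer.BirchSwinnertonDyer.Cruxes.SelmerRankUB.CruxAttack
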